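import Literature.AnabelianGeometry.EtaleTheta.KummerContainerValuationTransport
import HarnessLib

/-!
# Laws (V) (I) (P) of [IUTchI] Ex. 5.1 (v) BUNDLED at the genuine Kummer container of a number field

S. Mochizuki, *Inter-universal Teichmüller theory I*, kurims manuscript (May 2020), Ex. 5.1 (v) p. 128 l. 25–49
[claim: Mochizuki2012, status: disputed]: the unique isomorphism of cyclotomes is the one whose induced map of Kummer
containers is "compatible with the integral submonoids `𝒪^⊿_𝔭`"; (iv) p. 126 l. 35–38: `𝒪^⊿_𝔭 ⊆ 𝒪^×(A^birat) = F_mod^×`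
is "the submonoid of integral elements … with respect to the valuation determined by `𝔭`".  Container and Kummer map:
LANA Project interim report [LANA2026Report], §6.1 pp. 31–32 (tree: `kummerMap`, `H1Colimit`, `H1ColimTwist`).

PROOF-ONLY corollary file (abc-iut cell; no definition, no instance, no named fact) of abc-iut-w4-d057's
`KummerContainerValuationTransport.lean` (p433474: `valuationTransport_law`, `exists_reading_of_character`), for
GAP-LEDGER row G-w4d057g4-1 / sub-DAG row E51/L28: the three hypotheses `hval` (V), `hint` (I), `hpos` (P) of
`Literature.IUT.HodgeTheaters.UniqueCyclotomeIsoFamily.of_integral_laws` (p427568) are supplied SIMULTANEOUSLY at the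
arithmetic container `Γ_k ↷ k̄ˣ` of a NUMBER FIELD `k`, for the readings `val 𝔭` of the orders `ord_𝔭 = −log ∘ v_𝔭`
(Mathlib `HeightOneSpectrum.valuationOfNeZero`, whose convention is `v_𝔭(π) = exp(−1)` on a uniformiser):
* (R) `val 𝔭 (κ(ι x)) = ord_𝔭(x)` for all `x ∈ kˣ` (readings exist and are well defined on the layer `κ(kˣ)` without
  injectivity of `κ`: `exists_reading_of_character`);
* (V) `u(η(val 𝔭 h)) = η(val 𝔭 (u · h))` for `h ∈ κ(kˣ)` and every `u ∈ Ẑ^×` preserving the layer (`valuationTransport_law`);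
* (I) classes of `𝔭`-integral elements (`v_𝔭(x) ≤ 1`) have `val 𝔭 ≥ 0`;
* (P) some class of a `𝔭₀`-integral element has `val 𝔭₀ > 0` (a uniformiser at any finite prime; a number field has
  one: `𝓞 k` is not a field).
With `im₂ i₀ := κ(kˣ)`, `int₂ 𝔭 := κ(𝔭-integral elements of kˣ)`, `twist := H1ColimTwist` these are the binders of
`of_integral_laws` verbatim; what remains for the E51 holder is the identification of abc-iut-L5-t12's free
`CyclotomeComparisonFamily` with this container and laws (E)/(T) — NOT claimed here.

HONEST FRAMING: classical algebraic number theory, OUR kernel check; nothing here bears on [IUTchIII] Cor. 3.12 or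
asserts any statement of the disputed series.  Universe `Type` (Mathlib `groupCohomology`), as in the Kummer files.
-/

noncomputable section

open CategoryTheory groupCohomology ProfiniteGrp ProfiniteGrp.ProfiniteCompletion
open NumberField IsDedekindDomain

namespace Literature.AnabelianGeometry.EtaleTheta

/-- `𝔭`-integral units have non-positive additive `v_𝔭`-valuation in Mathlib's convention (`v_𝔭 ≤ 1` on integral
elements, `log v_𝔭 = −ord_𝔭`). [cite: NeukirchANT1999, Ch. I §11] -/
theorem toAdd_valuationOfNeZero_nonpos_of_valuation_le_one {k : Type*} [Field k] [NumberField k]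
    (𝔭 : HeightOneSpectrum (𝓞 k)) (x : kˣ) (hx : 𝔭.valuation k (x : k) ≤ 1) :
    Multiplicative.toAdd (𝔭.valuationOfNeZero (K := k) x) ≤ 0 := by
  rw [← 𝔭.valuationOfNeZero_eq (K := k) x, ← WithZero.coe_one, WithZero.coe_le_coe] at hx
  exact Multiplicative.toAdd_le.2 hx

variable (k : Type) [Field k] [NumberField k] {ι : Type} [Preorder ι] [DecidableEq ι] [IsDirectedOrder ι]
  [Nonempty ι] (S : ι → Subgroup (Field.absoluteGaloisGroup k)) (hS : ∀ ⦃i j : ι⦄, i ≤ j → S j ≤ S i)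

/-- **Laws (V) (I) (P) of [IUTchI] Ex. 5.1 (v) at the Kummer container of a number field, bundled.**  Let `k` be a
number field, `S` a directed exhaustive system of subgroups of `Γ_k` each containing `Gal(k̄/L_i)` for a finite `L_i/k`
(open systems qualify, `exists_finite_fixingSubgroup_le_of_isOpen`), `κ ∘ ι : kˣ → lim_{→} H¹(S i, Λ(k̄ˣ))` the Kummer
map on `kˣ`.  Then there are readings `val 𝔭` of the container, one for each finite prime `𝔭` of `k`, with
(R) `val 𝔭 (κ(ι x)) = ord_𝔭(x) = −log v_𝔭(x)`; (V) `u(η(val 𝔭 h)) = η(val 𝔭 (u · h))` for every `u ∈ Ẑ^× = Aut(Ẑ)`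
carrying the layer `κ(kˣ)` into itself and every `h` in the layer; (I) `0 ≤ val 𝔭 h` for `h` the class of a
`𝔭`-integral element; (P) `0 < val 𝔭₀ h` for some prime `𝔭₀` and some class `h` of a `𝔭₀`-integral element.
These are the hypotheses `hval`, `hint`, `hpos` of `UniqueCyclotomeIsoFamily.of_integral_laws` at `im₂ i₀ := κ(kˣ)`,
`int₂ 𝔭 := κ(𝔭-integral elements)`, `twist := H1ColimTwist`.
[cite: Mochizuki2012, IUTchI Ex. 5.1 (v) p. 128] [claim: Mochizuki2012, status: disputed] [cite: LANA2026Report, §6.1 pp. 31–32] -/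
theorem exists_valuation_laws_numberField (hc : IsExhausted (AlgebraicClosure k)ˣ S)
    (hfin : ∀ i, ∃ L : IntermediateField k (AlgebraicClosure k), FiniteDimensional k L ∧
      ∀ σ : Field.absoluteGaloisGroup k, Field.absoluteGaloisGroup.toAlgEquiv k σ ∈ L.fixingSubgroup → σ ∈ S i) :
    ∃ val : HeightOneSpectrum (𝓞 k) → H1Colimit (AlgebraicClosure k)ˣ S hS → ℤ,
      (∀ (𝔭 : HeightOneSpectrum (𝓞 k)) (x : kˣ),
        val 𝔭 (kummerMap hS hc (Units.map (algebraMap k (AlgebraicClosure k) : k →* AlgebraicClosure k) x)) =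
          -Multiplicative.toAdd (𝔭.valuationOfNeZero (K := k) x)) ∧
      (∀ u : MulAut (completion (GrpCat.of (Multiplicative ℤ))),
        Set.MapsTo (H1ColimTwist S hS u)
          (Set.range fun x : kˣ =>
            kummerMap hS hc (Units.map (algebraMap k (AlgebraicClosure k) : k →* AlgebraicClosure k) x))
          (Set.range fun x : kˣ =>
            kummerMap hS hc (Units.map (algebraMap k (AlgebraicClosure k) : k →* AlgebraicClosure k) x)) →
        ∀ h ∈ Set.range (fun x : kˣ =>
            kummerMap hS hc (Units.map (algebraMap k (AlgebraicClosure k) : k →* AlgebraicClosure k) x)),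
          ∀ 𝔭 : HeightOneSpectrum (𝓞 k),
            u (ZHatLevel.eta (val 𝔭 h)) = ZHatLevel.eta (val 𝔭 (H1ColimTwist S hS u h))) ∧
      (∀ (𝔭 : HeightOneSpectrum (𝓞 k)),
        ∀ h ∈ Set.range (fun x : kˣ =>
            kummerMap hS hc (Units.map (algebraMap k (AlgebraicClosure k) : k →* AlgebraicClosure k) x)),
          h ∈ (fun x : kˣ =>
              kummerMap hS hc (Units.map (algebraMap k (AlgebraicClosure k) : k →* AlgebraicClosure k) x)) ''
            {x : kˣ | 𝔭.valuation k (x : k) ≤ 1} →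
          0 ≤ val 𝔭 h) ∧
      (∃ 𝔭₀ : HeightOneSpectrum (𝓞 k),
        ∃ h ∈ Set.range (fun x : kˣ =>
            kummerMap hS hc (Units.map (algebraMap k (AlgebraicClosure k) : k →* AlgebraicClosure k) x)),
          h ∈ (fun x : kˣ =>
              kummerMap hS hc (Units.map (algebraMap k (AlgebraicClosure k) : k →* AlgebraicClosure k) x)) ''
            {x : kˣ | 𝔭₀.valuation k (x : k) ≤ 1} ∧
          0 < val 𝔭₀ h) := by
  classical
  -- the characters `ord_𝔭 = (v_𝔭 on kˣ)⁻¹ : kˣ →* ℤ`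
  let φ : HeightOneSpectrum (𝓞 k) → (kˣ →* Multiplicative ℤ) := fun 𝔭 => (𝔭.valuationOfNeZero (K := k))⁻¹
  -- readings of these characters on the container (well defined on the layer)
  choose val hval using fun 𝔭 => exists_reading_of_character k S hS hc hfin (φ 𝔭)
  have hread : ∀ (𝔭 : HeightOneSpectrum (𝓞 k)) (x : kˣ),
      val 𝔭 (kummerMap hS hc (Units.map (algebraMap k (AlgebraicClosure k) : k →* AlgebraicClosure k) x)) =
        -Multiplicative.toAdd (𝔭.valuationOfNeZero (K := k) x) := fun 𝔭 x => by
    rw [hval 𝔭 x]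
    change Multiplicative.toAdd (((𝔭.valuationOfNeZero (K := k))⁻¹ : kˣ →* Multiplicative ℤ) x) = _
    rw [MonoidHom.inv_apply, toAdd_inv]
  refine ⟨val, hread, fun u hu h hh 𝔭 => valuationTransport_law k S hS hc hfin φ val hval u hu h hh 𝔭, ?_, ?_⟩
  · -- (I): integral elements have non-negative order
    rintro 𝔭 h - ⟨x, hx1, rfl⟩
    rw [hread]
    have hle := toAdd_valuationOfNeZero_nonpos_of_valuation_le_one 𝔭 x hx1
    omega
  · -- (P): a uniformiser at some finite prime
    -- a finite prime exists: `𝓞 k` is not a field, so a maximal ideal is a nonzero prime (the same two lines are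
    -- `Literature.NumberTheory.Automorphic.nonempty_heightOneSpectrum`, not imported here to keep the closure small)
    obtain ⟨M, hM⟩ := Ideal.exists_maximal (𝓞 k)
    let 𝔭₀ : HeightOneSpectrum (𝓞 k) :=
      ⟨M, hM.isPrime, Ring.ne_bot_of_isMaximal_of_not_isField hM (RingOfIntegers.not_isField k)⟩
    obtain ⟨π, hπ⟩ := 𝔭₀.valuation_exists_uniformizer k
    have hπ0 : π ≠ 0 := by
      rintro rfl
      rw [map_zero] at hπ
      exact WithZero.exp_ne_zero hπ.symm
    have hx1 : 𝔭₀.valuation k ((Units.mk0 π hπ0 : kˣ) : k) ≤ 1 := by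
      rw [Units.val_mk0, hπ, ← WithZero.exp_zero, WithZero.exp_le_exp]
      norm_num
    have hval1 : val 𝔭₀ (kummerMap hS hc
        (Units.map (algebraMap k (AlgebraicClosure k) : k →* AlgebraicClosure k) (Units.mk0 π hπ0))) = 1 := by
      rw [hread]
      have h := 𝔭₀.valuationOfNeZero_eq (K := k) (Units.mk0 π hπ0)
      rw [Units.val_mk0, hπ, WithZero.exp_eq_coe_ofAdd, WithZero.coe_inj] at h
      rw [h, toAdd_ofAdd]
      norm_num
    exact ⟨𝔭₀, _, ⟨Units.mk0 π hπ0, rfl⟩, ⟨Units.mk0 π hπ0, hx1, rfl⟩, by rw [hval1]; exact one_pos⟩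

end Literature.AnabelianGeometry.EtaleTheta

end
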